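/-
Copyright (c) 2026 the pub-hodgecm-mathlib formalisation cell (harness21).  Prover seat hodgecm-mathlib-LH4-p11 (g7), req620 Track A «(D-RAM) FOUR-FRAME» squad
(dealer LH4-plan (g13) WORD #59 «(β′) (β) for a general ρ-compatible multiplier → LH4-p11 (g7)»; consumer LH4-p07 (g9) SCOPE (T5-P-cone) v1 §1 (W), (T5-P-cut)).
-/
import Summits.HodgeConjecture.HodgeConjecture.Theorems.F0P3cDyRamConeWeightHalfSplit   -- ★ p857610∕p857697 (this lineage, g5): (β) + §1 flip lemmas, ★ `exists_coneData_of_gen`, DEFS leaf, ★ T1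
import HarnessLib

/-!
# Crux `H413`, line LH4 «(D-RAM) FOUR-FRAME» — brick (β′): THE CONE WEIGHT ON A DEPTH CELL OF A GENERAL ρ-COMPATIBLE MULTIPLIER SUMS TO `q^b · #levelSetDep(j, b; μ)`

Cell `hodgecm-mathlib` (D-0151), FLOOR 0, crux item H413 = `stmt-HodgeConjecture-24833`, route of record `HCCMUnconditional`; squad F0∕P3c∕LH4, STAGE-1b letters
`stub_law_levLo ∕ stub_law_levHi ∕ stub_law_sq` of the tier-0 line `Cruxes/H413/Lines/F0_P3c_DyRamFourFrame.lean` ED. 5 through LH4-p07 (g9)'s census-law cone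
((T5-P-cut) `F0P3cDyRamJointProfileCensusCutoff`: cells `levelSetDep(j, b; (jE c)⁻¹(lam − jE u₀₀))`).  THEOREMS ONLY (no `def`, no instance, no notation, no `sorry`,
default heartbeats); lane `--supports stmt-HodgeConjecture-24833 --as helper` (count-neutral).

WHY A RE-PROOF.  ★ (β) `F0P3cDyRamConeWeightHalfSplit.finsum_levelSetDep_weight_eq_pow_mul_ncard` sums `Σᶠ_{Λ ∈ levelSetDep(j,b; lam − jE u)} f b j Λ = q^b·#cell` for the ONE
multiplier `lam − jE u` (syntactic).  The level pieces `lev_{a′,b′}` of STAGE-1b need the same identity on the cells of the SHIFTED multipliers `μ₁ = (jE c)⁻¹(lam − jE u₀₀)`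
(`c = ϖ^{a′}`) and, behind the guard, `μ₂` (LH4-p07 (g9) SCOPE §1 (W)).  Reading ★ (β)'s body: the multiplier enters only through (i) ★ `cell_clauses_map_mulLeft` — already
stated for an arbitrary multiplier `μ`; (ii) ★ `exists_coneData_of_gen`, whose outputs USED by (β) (`φ w₀ = Y⁻¹x₀`, `|⟨w₀,w₀⟩|·|ϖ|^{2b} = 1`) are `u`-free (only its discarded
tube output reads `u`); (iii) the VERBATIM `hf` agreement clause of ★ (C1), whose depth premise is `(lam − jE u)·b′ ∈ Λ`.

WHAT IS PROVED.  §1 (line side, generic): `levelSetDep(j,b; μ) ⊆ levelSetDep(j,b; κ·μ)` for `κ ∈ 𝒪_j` (a presented cell `Λ = x₀·𝒪_j` is an `𝒪_j`-module — ★ Literature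
`forall_mul_mem_iff_of_eq_mul_order`), and `ρ`-fixed integral elements lie in every order.  §2 (S1) MASTER `finsum_levelSetDep_weight_eq_pow_mul_ncard_of_subset`: ★ (β)'s frame
and `hf` VERBATIM, an ABSTRACT cell multiplier `μ : M` and ONE inclusion `levelSetDep(j,b; μ) ⊆ levelSetDep(j,b; lam − jE u)` ⟹
`Σᶠ_{Λ ∈ levelSetDep(j,b; μ)} f b j Λ = (Nat.card 𝓀[E])^b · #levelSetDep(j,b; μ)` — ★ (β)'s norm-flipping bijection `Λ ↦ z·Λ` run on the `μ`-cell (it is `μ`-generic by (i)),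
the cone data and the `hf` evaluations taken through the inclusion.  §3 (S2) `…_of_eq_mul`: the ρ-COMPATIBLE case `lam − jE u = κ·μ`, `κ ∈ 𝒪_j` (§1 discharges the
inclusion); (S3) `…_inv_mul`: LH4-p07 (g9)'s literal currency `μ = (jE c)⁻¹(lam − jE u)`, `c ∈ E`, `c ≠ 0`, `|c| ≤ 1` (`κ = jE c`).  ★ (β) itself is (S1) at `μ := lam − jE u`,
`hsub := subset_rfl`.  The `μ₂`-shallower branch is (S1) with the inclusion supplied by the guard (★ `levelSetDep_inter_levelSetDep_eq'` ∘ ★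
`levelSetDep_inter_levelSetDep_inv_mul_eq`).
HONEST LABEL.  Count-neutral lattice∕norm bookkeeping; nothing printed is asserted; `HC_CM` is proved only modulo the 7 printed citations (2 remaining named inputs: hLiu418 =
`stmt-HodgeConjecture-24832`, h413 = `stmt-HodgeConjecture-24833`) until rung 0 closes.

## References
* [Kottwitz1986BaseChangeUnits] R. E. Kottwitz, *Base change for unit elements of Hecke algebras*, Compositio Math. 60 (1986), §1 pp. 240–241 (fixed-lattice counts), §3
  pp. 247–249 (Levi blocks).
* [LabesseLanglands1979] J.-P. Labesse, R. P. Langlands, *L-indistinguishability for SL(2)*, Canad. J. Math. 31 (1979), §2 p. 8 (the norm-residue dichotomy in a quadratic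
  extension).
* [Serre1979] J.-P. Serre, *Local Fields*, GTM 67 (1979), Ch. III §6 Prop. 12 (orders of a quadratic extension); Ch. V §3 Prop. 5, Cor. 2–3 pp. 84–86 (norm groups).
* [Jacobowitz1962] R. Jacobowitz, *Hermitian forms over local fields*, Amer. J. Math. 84 (1962), §4 (dual lattices, gluing).
* [Flicker1998UnitaryFL] Y. Z. Flicker, *Elementary proof of a fundamental lemma for a unitary group*, Canad. J. Math. 50 (1998), p. 84 REMARK (multiplier criterion).
-/

set_option autoImplicit false

noncomputable section

open scoped Valued WithZero Matrix MatrixGroups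
open WithZero
open scoped Classical
open Literature.NumberTheory.Automorphic Literature.NumberTheory.Automorphic.HermitianLattice Literature.NumberTheory.Automorphic.UnitaryLatticeTree
open Literature.NumberTheory.Automorphic.UnitaryThreeFourFrame (IsRamifiedQuadraticDatum)
open Literature.NumberTheory.Automorphic.EllipticPlaneAsFieldLine
open Literature.NumberTheory.LocalFields.QuadraticOrder
open Literature.NumberTheory.LocalFields.WildQuadraticDatum
open Summit.HodgeConjecture.HodgeConjecture.Cruxes.H413.F0P3cDyRamToricCensusDefs
open Summit.HodgeConjecture.HodgeConjecture.Cruxes.H413.F0P3cDyRamConeLevelTransport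
open Summit.HodgeConjecture.HodgeConjecture.Cruxes.H413.F0P3cDyRamConeWeightHalfSplit

namespace Summit.HodgeConjecture.HodgeConjecture.Cruxes.H413.F0P3cDyRamConeWeightHalfSplitMultiplier

/-! ## §1 The μ-cell of a multiple: `levelSetDep(j,b; μ) ⊆ levelSetDep(j,b; κ·μ)` for `κ ∈ 𝒪_j` (line side, generic) -/

section LineSide

variable {M : Type*} [Field M] [Valued M ℤᵐ⁰] {ρ Θ : M →+* M} {α : M}

/-- A `ρ`-FIXED element of `M` of value `≤ 1` lies in the order of EVERY conductor `c` (`κ − ρκ = 0`). [cite: Serre1979, Ch. III §6 Prop. 12] -/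
theorem isOrd_of_map_eq_self {κ : M} (hρκ : ρ κ = κ) (hκ1 : Valued.v κ ≤ 1) (c : M) : IsOrd ρ α c κ :=
  ⟨hκ1, by rw [hρκ, sub_self, map_zero]; exact zero_le⟩

/-- **THE μ-CELL LIES IN THE `κ·μ`-CELL FOR `κ ∈ 𝒪_j`.**  A member `Λ = x₀·𝒪_j` of `levelSet(j, b)` is an `𝒪_j`-module (★ `forall_mul_mem_iff_of_eq_mul_order`), so the depth
clause `μ·Λ^♯ ⊆ Λ` gives `(κ·μ)·Λ^♯ = κ·(μ·Λ^♯) ⊆ Λ`:  `levelSetDep(j,b; μ) ⊆ levelSetDep(j,b; μ₀)` whenever `μ₀ = κ·μ`, `IsOrd ρ α (ϖE^j) κ`.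
[cite: Kottwitz1986BaseChangeUnits, §1 pp. 240–241] [cite: Flicker1998UnitaryFL, p. 84 REMARK] -/
theorem levelSetDep_subset_of_eq_mul (hvρ : ∀ x, Valued.v (ρ x) = Valued.v x) {ϖE h : M} {j b : ℕ} {κ μ μ₀ : M}
    (hκ : IsOrd ρ α (ϖE ^ j) κ) (hμ₀ : μ₀ = κ * μ) :
    levelSetDep ρ Θ α ϖE h j b μ ⊆ levelSetDep ρ Θ α ϖE h j b μ₀ := by
  intro Λ hΛ
  obtain ⟨⟨x₀, hx₀, hΛx, hyO, hyprim, hylev⟩, hdep⟩ := hΛ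
  refine ⟨⟨x₀, hx₀, hΛx, hyO, hyprim, hylev⟩, fun b' hb' => ?_⟩
  rw [hμ₀, mul_assoc]
  exact (forall_mul_mem_iff_of_eq_mul_order hvρ hx₀ hΛx κ).2 hκ _ (hdep b' hb')

end LineSide

/-! ## §2 (S1) MASTER — the cone weight on a μ-cell lying inside the `(lam − jE u)`-cell -/

section Head

variable {E : Type} {M : Type*} [Field E] [Valued E ℤᵐ⁰] [Field M] [Valued M ℤᵐ⁰] {ρ Θ : M →+* M} {α : M}

/-- **(β′)(S1) THE CONE WEIGHT ON A DEPTH CELL OF AN ABSTRACT MULTIPLIER (MASTER).**  Frame of ★ (β) `F0P3cDyRamConeWeightHalfSplit.finsum_levelSetDep_weight_eq_pow_mul_ncard`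
VERBATIM (★ (C1)'s plane∕line model, the E-side wild datum of ★ T1, the flip unit `z` with `z·Θz = jE ξ`, `ξ` a `σ`-fixed NON-NORM; the weight `f` with ★ (C1)'s agreement
clause `hf` VERBATIM — depth premise `(lam − jE u)·b′ ∈ Λ`), an ABSTRACT cell multiplier `μ : M` and ONE inclusion `levelSetDep(j,b; μ) ⊆ levelSetDep(j,b; lam − jE u)`.  Then
for `b ≥ 1` and `lam ∈ 𝒪_j`:  `Σᶠ_{Λ ∈ levelSetDep(j,b; μ)} f b j Λ = (Nat.card 𝓀[E])^b · #levelSetDep(j,b; μ)`.  PROOF = ★ (β)'s: `Λ ↦ z·Λ` is a bijection of the μ-cell (★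
`cell_clauses_map_mulLeft` is μ-generic), each cell carries a `σ`-fixed unit `r₀` with `jE r₀ = glueUnit(x₀, b)` (★ `exists_coneData_of_gen` through the inclusion), the flipped
cell carries `r₀∕ξ`, and `#Sol_{2b}(r₀) + #Sol_{2b}(r₀∕ξ) = 2q^b` (★ `natCard_normFibre_add_natCard_normFibre_div_eq`).
[cite: Kottwitz1986BaseChangeUnits, §1 pp. 240–241] [cite: Serre1979, Ch. V §3 Prop. 5, Cor. 2–3 pp. 84–86] [cite: LabesseLanglands1979, §2 p. 8] [cite: Jacobowitz1962, §4] -/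
theorem finsum_levelSetDep_weight_eq_pow_mul_ncard_of_subset [CompleteSpace E] [IsDiscreteValuationRing 𝒪[E]] [Finite 𝓀[E]]
    (σ : E →+* E) (hσ : ∀ a, σ (σ a) = a) (hvσ : ∀ a, Valued.v (σ a) = Valued.v a)
    {ϖ : E} (hϖ : Valued.v ϖ = WithZero.exp (-1 : ℤ)) {d t : ℕ} (hD : IsRamifiedQuadraticDatum σ ϖ d t) (h2v : Valued.v (2 : E) < 1)
    {H₂ : Matrix (Fin 2) (Fin 2) E} (hH₂σ : (H₂.map σ)ᵀ = H₂) {hW : E} (hhW : Valued.v hW = 1) (hhWσ : σ hW = hW) (jE : E →+* M)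
    (hρρ : ∀ x, ρ (ρ x) = x) (hvρ : ∀ x, Valued.v (ρ x) = Valued.v x) (hα : ρ α ≠ α) (hα1 : Valued.v α ≤ 1)
    (hint : ∀ z : M, Valued.v z ≤ 1 → Valued.v ((z - ρ z) / (α - ρ α)) ≤ 1)
    (hΘΘ : ∀ x, Θ (Θ x) = x) (hΘρ : ∀ x, Θ (ρ x) = ρ (Θ x)) (hvΘ : ∀ x, Valued.v (Θ x) = Valued.v x) (hΘj : ∀ x, Θ (jE x) = jE (σ x))
    (hjv : ∀ c, Valued.v (jE c) ≤ 1 ↔ Valued.v c ≤ 1) (hjfix : ∀ z, ρ z = z ↔ ∃ c, jE c = z)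
    (hjpow : ∀ (t : E) (n : ℤ), Valued.v (jE t) = Valued.v (jE ϖ) ^ n ↔ Valued.v t = Valued.v ϖ ^ n)
    (hϖmax : ∀ t : M, ρ t = t → Valued.v t < 1 → Valued.v t ≤ Valued.v (jE ϖ))
    (φ : (Fin 2 → E) →+ M) (hφs : ∀ (c : E) (x : Fin 2 → E), φ (c • x) = jE c * φ x) (hφi : Function.Injective φ) (hφo : Function.Surjective φ)
    {γ₂ : GL (Fin 2) E} {lam h : M} (hφγ : ∀ x, φ ((γ₂ : Matrix (Fin 2) (Fin 2) E).mulVec x) = lam * φ x) (hlam : Valued.v lam = 1)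
    (hΘh : Θ h = h) (hh : h ≠ 0) (hform : ∀ x y, jE (pairing σ H₂ x y) = h * Θ (φ x) * φ y + ρ (h * Θ (φ x) * φ y))
    (z : M) (hz1 : Valued.v z = 1) (ξ : E) (hzξ : z * Θ z = jE ξ) (hσξ : σ ξ = ξ) (hξN : ¬ ∃ e : E, e * σ e = ξ)
    (u : E) (μ : M) {b : ℕ} (hb : 1 ≤ b) {j : ℕ} (hlamj : IsOrd ρ α (jE ϖ ^ j) lam)
    (hsub : levelSetDep ρ Θ α (jE ϖ) h j b μ ⊆ levelSetDep ρ Θ α (jE ϖ) h j b (lam - jE u)) (hfin : (levelSet ρ Θ α (jE ϖ) h j b).Finite)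
    (f : ℕ → ℕ → AddSubgroup M → ℕ)
    (hf : ∀ (b j : ℕ) (Λ : AddSubgroup M) (x₀ : M) (r : E), 1 ≤ b → x₀ ≠ 0 →
      (∀ x, x ∈ Λ ↔ ∃ z, IsOrd ρ α (jE ϖ ^ j) z ∧ x = x₀ * z) →
      IsOrd ρ α (jE ϖ ^ j) (dualGen ρ Θ α (jE ϖ ^ j) h x₀) → ¬ IsOrd ρ α (jE ϖ ^ j) (dualGen ρ Θ α (jE ϖ ^ j) h x₀ / jE ϖ) →
      Valued.v (dualGen ρ Θ α (jE ϖ ^ j) h x₀) = Valued.v (jE ϖ) ^ b →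
      (∀ b', (∀ x ∈ Λ, Valued.v (h * Θ x * b' + ρ (h * Θ x * b')) ≤ 1) → (lam - jE u) * b' ∈ Λ) →
      IsOrd ρ α (jE ϖ ^ j) lam → jE r = glueUnit ρ Θ α (jE ϖ ^ j) h (jE ϖ) (jE hW) x₀ b →
      f b j Λ = Nat.card {x : 𝒪[E] ⧸ 𝓂[E] ^ (2 * b) // ∃ u' : 𝒪[E], Ideal.Quotient.mk (𝓂[E] ^ (2 * b)) u' = x ∧
        Valued.v ((u' : E) * σ u' - r) ≤ Valued.v (ϖ ^ (2 * b))}) :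
    ∑ᶠ Λ ∈ levelSetDep ρ Θ α (jE ϖ) h j b μ, f b j Λ = Nat.card 𝓀[E] ^ b * (levelSetDep ρ Θ α (jE ϖ) h j b μ).ncard := by
  classical
  -- scalars
  have hvϖ0 : Valued.v ϖ ≠ 0 := by rw [hϖ]; exact WithZero.exp_ne_zero
  have hϖ0 : ϖ ≠ 0 := fun h0 => by rw [h0, map_zero] at hvϖ0; exact hvϖ0 rfl
  have hϖ1 : Valued.v ϖ < 1 := by rw [hϖ, ← WithZero.exp_zero, WithZero.exp_lt_exp]; norm_num
  set ϖE : M := jE ϖ with hϖE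
  set c : M := ϖE ^ j with hcdef
  have hρϖ : ρ ϖE = ϖE := (hjfix ϖE).2 ⟨ϖ, rfl⟩
  have hϖE0 : ϖE ≠ 0 := (map_ne_zero jE).2 hϖ0
  have hϖE1 : Valued.v ϖE < 1 := by
    refine lt_of_le_of_ne ((hjv ϖ).2 hϖ1.le) fun hle => ?_
    have := (hjpow ϖ 0).1 (by rw [zpow_zero]; exact hle)
    rw [zpow_zero] at this
    exact hϖ1.ne this
  have hc : ρ c = c := by rw [hcdef, map_pow, hρϖ]
  have hc0 : c ≠ 0 := pow_ne_zero j hϖE0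
  have hc1 : Valued.v c ≤ 1 := by rw [hcdef, map_pow]; exact pow_le_one₀ zero_le hϖE1.le
  have hd0 : α - ρ α ≠ 0 := sub_ne_zero.2 (Ne.symm hα)
  -- the flip unit and its inverse
  set ξ' : M := jE ξ with hξ'def
  have hρξ' : ρ ξ' = ξ' := (hjfix ξ').2 ⟨ξ, rfl⟩
  have hξ'1 : Valued.v ξ' = 1 := by rw [← hzξ, map_mul, hvΘ, hz1, one_mul]
  have hξ'0 : ξ' ≠ 0 := fun h0 => by rw [h0, map_zero] at hξ'1; exact zero_ne_one hξ'1
  have hξ1 : Valued.v ξ = 1 := by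
    have := (hjpow ξ 0).1 (by rw [zpow_zero]; exact hξ'1)
    rwa [zpow_zero] at this
  have hz0 : z ≠ 0 := fun h0 => by rw [h0, map_zero] at hz1; exact zero_ne_one hz1
  have hzi0 : z⁻¹ ≠ 0 := inv_ne_zero hz0
  have hziξ : z⁻¹ * Θ z⁻¹ = ξ'⁻¹ := by rw [map_inv₀, ← mul_inv, hzξ]
  have hρξi : ρ ξ'⁻¹ = ξ'⁻¹ := by rw [map_inv₀, hρξ']
  have hξi1 : Valued.v ξ'⁻¹ = 1 := by rw [map_inv₀, hξ'1, inv_one]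
  -- the hermitian symmetry of `H₂` in the shape ★ `pairing_comm_of_hermitian` wants
  have hH : ∀ a b', σ (H₂ a b') = H₂ b' a := by
    intro a b'
    have := congrFun (congrFun hH₂σ b') a
    simpa [Matrix.transpose_apply, Matrix.map_apply] using this
  -- the cell and its finiteness
  set D : Set (AddSubgroup M) := levelSetDep ρ Θ α ϖE h j b μ with hDdef
  have hDfin : D.Finite := hfin.subset (levelSetDep_subset ρ Θ α ϖE h j b μ)
  -- the flip and its inverse on additive subgroups
  set Φ : AddSubgroup M → AddSubgroup M := fun Λ => Λ.map (AddMonoidHom.mulLeft z) with hΦ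
  set Ψ : AddSubgroup M → AddSubgroup M := fun Λ => Λ.map (AddMonoidHom.mulLeft z⁻¹) with hΨ
  have hcompΨΦ : (AddMonoidHom.mulLeft z⁻¹).comp (AddMonoidHom.mulLeft z) = AddMonoidHom.id M := by
    ext x; simp [inv_mul_cancel_left₀ hz0]
  have hcompΦΨ : (AddMonoidHom.mulLeft z).comp (AddMonoidHom.mulLeft z⁻¹) = AddMonoidHom.id M := by
    ext x; simp [mul_inv_cancel_left₀ hz0]
  have hΨΦ : ∀ Λ, Ψ (Φ Λ) = Λ := fun Λ => by
    simp only [hΦ, hΨ, AddSubgroup.map_map, hcompΨΦ, AddSubgroup.map_id]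
  have hΦΨ : ∀ Λ, Φ (Ψ Λ) = Λ := fun Λ => by
    simp only [hΦ, hΨ, AddSubgroup.map_map, hcompΦΨ, AddSubgroup.map_id]
  -- the flip (either direction) maps the cell to itself
  have hmaps : ∀ {z₁ ξ₁ : M}, z₁ ≠ 0 → z₁ * Θ z₁ = ξ₁ → ρ ξ₁ = ξ₁ → Valued.v ξ₁ = 1 →
      ∀ Λ ∈ D, Λ.map (AddMonoidHom.mulLeft z₁) ∈ D := by
    intro z₁ ξ₁ hz₁ hzξ₁ hρξ₁ hξ₁1 Λ hΛ
    obtain ⟨⟨x₀, hx₀, hΛx, hyO, hyprim, hylev⟩, hdepΛ⟩ := hΛ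
    obtain ⟨hzx₀, hΛ'x, hyO', hyprim', hylev', hdep'⟩ :=
      cell_clauses_map_mulLeft hρρ hvρ hα hα1 hint hΘΘ hΘρ hvΘ hc hc0 hc1 hh hz₁ hzξ₁ hρξ₁ hξ₁1 ϖE μ b hx₀ hΛx hyO hyprim hylev hdepΛ
    exact ⟨⟨z₁ * x₀, hzx₀, hΛ'x, hyO', hyprim', hylev'⟩, hdep'⟩
  have hmapsΦ : ∀ Λ ∈ D, Φ Λ ∈ D := hmaps hz0 hzξ hρξ' hξ'1
  have hmapsΨ : ∀ Λ ∈ D, Ψ Λ ∈ D := hmaps hzi0 hziξ hρξi hξi1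
  -- the value of a flipped pair
  have hpair : ∀ Λ ∈ D, f b j Λ + f b j (Φ Λ) = 2 * Nat.card 𝓀[E] ^ b := by
    intro Λ hΛ
    -- the depth clause for the `hf`∕cone-data multiplier `lam − jE u` (the μ-cell lies inside the `(lam − jE u)`-cell)
    have hdepU : ∀ b', (∀ x ∈ Λ, Valued.v (h * Θ x * b' + ρ (h * Θ x * b')) ≤ 1) → (lam - jE u) * b' ∈ Λ := (hsub hΛ).2
    obtain ⟨⟨x₀, hx₀, hΛx, hyO, hyprim, hylev⟩, -⟩ := hΛ
    -- the canonical cone data of the cell: a `σ`-fixed unit `r₀ ∈ E` with `jE r₀ = glueUnit(x₀, b)`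
    obtain ⟨B', -, -, -, w₀, hw₀Y, -, -, hw₀, -⟩ := exists_coneData_of_gen σ hϖ0 hϖ1 H₂ jE hρρ hvρ hα hα1 hint hΘΘ hΘρ hvΘ hjv hjfix hjpow hϖmax
      φ hφs hφi hφo hφγ hlam hΘh hh hform u hb hx₀ hΛx hyO hyprim hylev hdepU hlamj
    set r₀ : E := -(pairing σ H₂ w₀ w₀) * (ϖ ^ b * σ (ϖ ^ b)) / hW with hr₀def
    have hr₀ : jE r₀ = glueUnit ρ Θ α c h ϖE (jE hW) x₀ b := map_glueNorm_eq σ H₂ jE hΘj φ hform hw₀Y ϖ hW b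
    have hpair₀ : σ (pairing σ H₂ w₀ w₀) = pairing σ H₂ w₀ w₀ := (pairing_comm_of_hermitian hσ hH w₀ w₀).symm
    have hσr₀ : σ r₀ = r₀ := by
      rw [hr₀def, map_div₀, map_mul, map_neg, hpair₀, map_mul, hσ, hhWσ, mul_comm (σ (ϖ ^ b)) (ϖ ^ b)]
    have hr₀1 : Valued.v r₀ = 1 := by
      rw [hr₀def, map_div₀, map_mul, Valuation.map_neg, map_mul, hvσ, map_pow, hhW, div_one, ← pow_add, ← two_mul]
      exact hw₀
    -- the flipped cell is presented by `z·x₀` and carries `r₀ ∕ ξ`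
    obtain ⟨hzx₀, hΛ'x, hyO', hyprim', hylev', hdep'⟩ :=
      cell_clauses_map_mulLeft hρρ hvρ hα hα1 hint hΘΘ hΘρ hvΘ hc hc0 hc1 hh hz0 hzξ hρξ' hξ'1 ϖE (lam - jE u) b hx₀ hΛx hyO hyprim hylev hdepU
    have hY0 : dualGen ρ Θ α c h x₀ ≠ 0 := by
      rw [dualGen_def]
      exact mul_ne_zero (mul_ne_zero hh (mul_ne_zero hx₀ ((map_ne_zero Θ).2 hx₀))) (mul_ne_zero hc0 hd0)
    have hr₀' : jE (r₀ / ξ) = glueUnit ρ Θ α c h ϖE (jE hW) (z * x₀) b := by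
      rw [map_div₀, hr₀, glueUnit_mul_left hΘΘ hzξ hρξ' hξ'0 hY0]
    rw [hf b j Λ x₀ r₀ hb hx₀ hΛx hyO hyprim hylev hdepU hlamj hr₀,
      hf b j (Φ Λ) (z * x₀) (r₀ / ξ) hb hzx₀ hΛ'x hyO' hyprim' hylev' hdep' hlamj hr₀']
    exact natCard_normFibre_add_natCard_normFibre_div_eq hD h2v hσr₀ hr₀1 hσξ hξ1 hξN hb
  -- summation over the bijection
  rw [finsum_mem_eq_finite_toFinset_sum _ hDfin, Set.ncard_eq_toFinset_card _ hDfin]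
  set T := hDfin.toFinset with hTdef
  have hT : ∀ Λ, Λ ∈ T ↔ Λ ∈ D := fun Λ => Set.Finite.mem_toFinset hDfin
  have hreidx : ∑ Λ ∈ T, f b j (Φ Λ) = ∑ Λ ∈ T, f b j Λ :=
    Finset.sum_nbij' Φ Ψ (fun Λ hΛ => (hT _).2 (hmapsΦ Λ ((hT Λ).1 hΛ))) (fun Λ hΛ => (hT _).2 (hmapsΨ Λ ((hT Λ).1 hΛ)))
      (fun Λ _ => hΨΦ Λ) (fun Λ _ => hΦΨ Λ) (fun _ _ => rfl)
  have h2 : 2 * ∑ Λ ∈ T, f b j Λ = 2 * (Nat.card 𝓀[E] ^ b * T.card) := by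
    calc 2 * ∑ Λ ∈ T, f b j Λ = ∑ Λ ∈ T, f b j Λ + ∑ Λ ∈ T, f b j (Φ Λ) := by rw [two_mul, hreidx]
      _ = ∑ Λ ∈ T, (f b j Λ + f b j (Φ Λ)) := Finset.sum_add_distrib.symm
      _ = ∑ Λ ∈ T, 2 * Nat.card 𝓀[E] ^ b := Finset.sum_congr rfl fun Λ hΛ => hpair Λ ((hT Λ).1 hΛ)
      _ = 2 * (Nat.card 𝓀[E] ^ b * T.card) := by rw [Finset.sum_const, smul_eq_mul]; ring
  exact Nat.eq_of_mul_eq_mul_left (by norm_num) h2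

/-! ## §3 (S2)(S3) The ρ-compatible multiplier and the shifted depth multiplier `(jE c)⁻¹(lam − jE u)` -/

/-- **(β′)(S2) THE ρ-COMPATIBLE MULTIPLIER**: `lam − jE u = κ·μ` with `κ ∈ 𝒪_j` (`IsOrd ρ α (jE ϖ^j) κ`; e.g. `κ = jE c`, `c ∈ 𝒪_E`).  (S1) with the inclusion discharged by
§1 `levelSetDep_subset_of_eq_mul`:  `Σᶠ_{Λ ∈ levelSetDep(j,b; μ)} f b j Λ = (Nat.card 𝓀[E])^b · #levelSetDep(j,b; μ)`.
[cite: Kottwitz1986BaseChangeUnits, §1 pp. 240–241] [cite: Serre1979, Ch. V §3 Prop. 5, Cor. 2–3 pp. 84–86] [cite: LabesseLanglands1979, §2 p. 8] [cite: Jacobowitz1962, §4] -/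
theorem finsum_levelSetDep_weight_eq_pow_mul_ncard_of_eq_mul [CompleteSpace E] [IsDiscreteValuationRing 𝒪[E]] [Finite 𝓀[E]]
    (σ : E →+* E) (hσ : ∀ a, σ (σ a) = a) (hvσ : ∀ a, Valued.v (σ a) = Valued.v a)
    {ϖ : E} (hϖ : Valued.v ϖ = WithZero.exp (-1 : ℤ)) {d t : ℕ} (hD : IsRamifiedQuadraticDatum σ ϖ d t) (h2v : Valued.v (2 : E) < 1)
    {H₂ : Matrix (Fin 2) (Fin 2) E} (hH₂σ : (H₂.map σ)ᵀ = H₂) {hW : E} (hhW : Valued.v hW = 1) (hhWσ : σ hW = hW) (jE : E →+* M)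
    (hρρ : ∀ x, ρ (ρ x) = x) (hvρ : ∀ x, Valued.v (ρ x) = Valued.v x) (hα : ρ α ≠ α) (hα1 : Valued.v α ≤ 1)
    (hint : ∀ z : M, Valued.v z ≤ 1 → Valued.v ((z - ρ z) / (α - ρ α)) ≤ 1)
    (hΘΘ : ∀ x, Θ (Θ x) = x) (hΘρ : ∀ x, Θ (ρ x) = ρ (Θ x)) (hvΘ : ∀ x, Valued.v (Θ x) = Valued.v x) (hΘj : ∀ x, Θ (jE x) = jE (σ x))
    (hjv : ∀ c, Valued.v (jE c) ≤ 1 ↔ Valued.v c ≤ 1) (hjfix : ∀ z, ρ z = z ↔ ∃ c, jE c = z)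
    (hjpow : ∀ (t : E) (n : ℤ), Valued.v (jE t) = Valued.v (jE ϖ) ^ n ↔ Valued.v t = Valued.v ϖ ^ n)
    (hϖmax : ∀ t : M, ρ t = t → Valued.v t < 1 → Valued.v t ≤ Valued.v (jE ϖ))
    (φ : (Fin 2 → E) →+ M) (hφs : ∀ (c : E) (x : Fin 2 → E), φ (c • x) = jE c * φ x) (hφi : Function.Injective φ) (hφo : Function.Surjective φ)
    {γ₂ : GL (Fin 2) E} {lam h : M} (hφγ : ∀ x, φ ((γ₂ : Matrix (Fin 2) (Fin 2) E).mulVec x) = lam * φ x) (hlam : Valued.v lam = 1)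
    (hΘh : Θ h = h) (hh : h ≠ 0) (hform : ∀ x y, jE (pairing σ H₂ x y) = h * Θ (φ x) * φ y + ρ (h * Θ (φ x) * φ y))
    (z : M) (hz1 : Valued.v z = 1) (ξ : E) (hzξ : z * Θ z = jE ξ) (hσξ : σ ξ = ξ) (hξN : ¬ ∃ e : E, e * σ e = ξ)
    (u : E) (μ : M) {b : ℕ} (hb : 1 ≤ b) {j : ℕ} (hlamj : IsOrd ρ α (jE ϖ ^ j) lam) {κ : M} (hκ : IsOrd ρ α (jE ϖ ^ j) κ) (hμ : lam - jE u = κ * μ)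
    (hfin : (levelSet ρ Θ α (jE ϖ) h j b).Finite)
    (f : ℕ → ℕ → AddSubgroup M → ℕ)
    (hf : ∀ (b j : ℕ) (Λ : AddSubgroup M) (x₀ : M) (r : E), 1 ≤ b → x₀ ≠ 0 →
      (∀ x, x ∈ Λ ↔ ∃ z, IsOrd ρ α (jE ϖ ^ j) z ∧ x = x₀ * z) →
      IsOrd ρ α (jE ϖ ^ j) (dualGen ρ Θ α (jE ϖ ^ j) h x₀) → ¬ IsOrd ρ α (jE ϖ ^ j) (dualGen ρ Θ α (jE ϖ ^ j) h x₀ / jE ϖ) →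
      Valued.v (dualGen ρ Θ α (jE ϖ ^ j) h x₀) = Valued.v (jE ϖ) ^ b →
      (∀ b', (∀ x ∈ Λ, Valued.v (h * Θ x * b' + ρ (h * Θ x * b')) ≤ 1) → (lam - jE u) * b' ∈ Λ) →
      IsOrd ρ α (jE ϖ ^ j) lam → jE r = glueUnit ρ Θ α (jE ϖ ^ j) h (jE ϖ) (jE hW) x₀ b →
      f b j Λ = Nat.card {x : 𝒪[E] ⧸ 𝓂[E] ^ (2 * b) // ∃ u' : 𝒪[E], Ideal.Quotient.mk (𝓂[E] ^ (2 * b)) u' = x ∧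
        Valued.v ((u' : E) * σ u' - r) ≤ Valued.v (ϖ ^ (2 * b))}) :
    ∑ᶠ Λ ∈ levelSetDep ρ Θ α (jE ϖ) h j b μ, f b j Λ = Nat.card 𝓀[E] ^ b * (levelSetDep ρ Θ α (jE ϖ) h j b μ).ncard :=
  finsum_levelSetDep_weight_eq_pow_mul_ncard_of_subset σ hσ hvσ hϖ hD h2v hH₂σ hhW hhWσ jE hρρ hvρ hα hα1 hint hΘΘ hΘρ hvΘ hΘj hjv hjfix hjpow hϖmax
    φ hφs hφi hφo hφγ hlam hΘh hh hform z hz1 ξ hzξ hσξ hξN u μ hb hlamj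
    (levelSetDep_subset_of_eq_mul hvρ hκ hμ) hfin f hf

/-- **(β′)(S3) THE SHIFTED DEPTH MULTIPLIER `μ₁ = (jE c)⁻¹·(lam − jE u)`** (`c ∈ E`, `c ≠ 0`, `|c| ≤ 1`; the cells of LH4-p07 (g9)'s (T5-P-cut) cone at `c = ϖ^{a′}`, tokens
`(m₁, jl₁) = (m − a′, jl − a′)`):  `Σᶠ_{Λ ∈ levelSetDep(j,b; (jE c)⁻¹(lam − jE u))} f b j Λ = (Nat.card 𝓀[E])^b · #levelSetDep(j,b; (jE c)⁻¹(lam − jE u))` — (S2) at `κ = jE c`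
(`ρ`-fixed, `|jE c| ≤ 1`, so `jE c ∈ 𝒪_j` for every `j`).
[cite: Kottwitz1986BaseChangeUnits, §1 pp. 240–241] [cite: Serre1979, Ch. V §3 Prop. 5, Cor. 2–3 pp. 84–86] [cite: LabesseLanglands1979, §2 p. 8] [cite: Jacobowitz1962, §4] -/
theorem finsum_levelSetDep_weight_eq_pow_mul_ncard_inv_mul [CompleteSpace E] [IsDiscreteValuationRing 𝒪[E]] [Finite 𝓀[E]]
    (σ : E →+* E) (hσ : ∀ a, σ (σ a) = a) (hvσ : ∀ a, Valued.v (σ a) = Valued.v a)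
    {ϖ : E} (hϖ : Valued.v ϖ = WithZero.exp (-1 : ℤ)) {d t : ℕ} (hD : IsRamifiedQuadraticDatum σ ϖ d t) (h2v : Valued.v (2 : E) < 1)
    {H₂ : Matrix (Fin 2) (Fin 2) E} (hH₂σ : (H₂.map σ)ᵀ = H₂) {hW : E} (hhW : Valued.v hW = 1) (hhWσ : σ hW = hW) (jE : E →+* M)
    (hρρ : ∀ x, ρ (ρ x) = x) (hvρ : ∀ x, Valued.v (ρ x) = Valued.v x) (hα : ρ α ≠ α) (hα1 : Valued.v α ≤ 1)
    (hint : ∀ z : M, Valued.v z ≤ 1 → Valued.v ((z - ρ z) / (α - ρ α)) ≤ 1)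
    (hΘΘ : ∀ x, Θ (Θ x) = x) (hΘρ : ∀ x, Θ (ρ x) = ρ (Θ x)) (hvΘ : ∀ x, Valued.v (Θ x) = Valued.v x) (hΘj : ∀ x, Θ (jE x) = jE (σ x))
    (hjv : ∀ c, Valued.v (jE c) ≤ 1 ↔ Valued.v c ≤ 1) (hjfix : ∀ z, ρ z = z ↔ ∃ c, jE c = z)
    (hjpow : ∀ (t : E) (n : ℤ), Valued.v (jE t) = Valued.v (jE ϖ) ^ n ↔ Valued.v t = Valued.v ϖ ^ n)
    (hϖmax : ∀ t : M, ρ t = t → Valued.v t < 1 → Valued.v t ≤ Valued.v (jE ϖ))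
    (φ : (Fin 2 → E) →+ M) (hφs : ∀ (c : E) (x : Fin 2 → E), φ (c • x) = jE c * φ x) (hφi : Function.Injective φ) (hφo : Function.Surjective φ)
    {γ₂ : GL (Fin 2) E} {lam h : M} (hφγ : ∀ x, φ ((γ₂ : Matrix (Fin 2) (Fin 2) E).mulVec x) = lam * φ x) (hlam : Valued.v lam = 1)
    (hΘh : Θ h = h) (hh : h ≠ 0) (hform : ∀ x y, jE (pairing σ H₂ x y) = h * Θ (φ x) * φ y + ρ (h * Θ (φ x) * φ y))
    (z : M) (hz1 : Valued.v z = 1) (ξ : E) (hzξ : z * Θ z = jE ξ) (hσξ : σ ξ = ξ) (hξN : ¬ ∃ e : E, e * σ e = ξ)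
    (u : E) {c : E} (hc : c ≠ 0) (hc1 : Valued.v c ≤ 1) {b : ℕ} (hb : 1 ≤ b) {j : ℕ} (hlamj : IsOrd ρ α (jE ϖ ^ j) lam)
    (hfin : (levelSet ρ Θ α (jE ϖ) h j b).Finite)
    (f : ℕ → ℕ → AddSubgroup M → ℕ)
    (hf : ∀ (b j : ℕ) (Λ : AddSubgroup M) (x₀ : M) (r : E), 1 ≤ b → x₀ ≠ 0 →
      (∀ x, x ∈ Λ ↔ ∃ z, IsOrd ρ α (jE ϖ ^ j) z ∧ x = x₀ * z) →
      IsOrd ρ α (jE ϖ ^ j) (dualGen ρ Θ α (jE ϖ ^ j) h x₀) → ¬ IsOrd ρ α (jE ϖ ^ j) (dualGen ρ Θ α (jE ϖ ^ j) h x₀ / jE ϖ) →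
      Valued.v (dualGen ρ Θ α (jE ϖ ^ j) h x₀) = Valued.v (jE ϖ) ^ b →
      (∀ b', (∀ x ∈ Λ, Valued.v (h * Θ x * b' + ρ (h * Θ x * b')) ≤ 1) → (lam - jE u) * b' ∈ Λ) →
      IsOrd ρ α (jE ϖ ^ j) lam → jE r = glueUnit ρ Θ α (jE ϖ ^ j) h (jE ϖ) (jE hW) x₀ b →
      f b j Λ = Nat.card {x : 𝒪[E] ⧸ 𝓂[E] ^ (2 * b) // ∃ u' : 𝒪[E], Ideal.Quotient.mk (𝓂[E] ^ (2 * b)) u' = x ∧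
        Valued.v ((u' : E) * σ u' - r) ≤ Valued.v (ϖ ^ (2 * b))}) :
    ∑ᶠ Λ ∈ levelSetDep ρ Θ α (jE ϖ) h j b ((jE c)⁻¹ * (lam - jE u)), f b j Λ =
      Nat.card 𝓀[E] ^ b * (levelSetDep ρ Θ α (jE ϖ) h j b ((jE c)⁻¹ * (lam - jE u))).ncard :=
  finsum_levelSetDep_weight_eq_pow_mul_ncard_of_eq_mul σ hσ hvσ hϖ hD h2v hH₂σ hhW hhWσ jE hρρ hvρ hα hα1 hint hΘΘ hΘρ hvΘ hΘj hjv hjfix hjpow hϖmax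
    φ hφs hφi hφo hφγ hlam hΘh hh hform z hz1 ξ hzξ hσξ hξN u ((jE c)⁻¹ * (lam - jE u)) hb hlamj
    (isOrd_of_map_eq_self ((hjfix (jE c)).2 ⟨c, rfl⟩) ((hjv c).2 hc1) (jE ϖ ^ j)) (mul_inv_cancel_left₀ ((map_ne_zero jE).2 hc) (lam - jE u)).symm hfin f hf

end Head

end Summit.HodgeConjecture.HodgeConjecture.Cruxes.H413.F0P3cDyRamConeWeightHalfSplitMultiplier

end
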